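import Summits.QuantumAdvantage.QuantumAdvantage.Theorems.CharDialPartyDialG1

/-!
# PartyDial (decomp-qadv lens-5 g35), part G2 — §6b–c: fan-in selection (isPairLocal_of_fanIn), fanInLaw 35/36, pieces PairFrobOdd / FanInFrobOdd / LocalFrobOdd PROVED, FrobHardOdd iff KnottedFrobOdd

See part A (`CharDialPartyDialA`) for the node header; memo `NODE-g35.md` (g35 folder of decomp-qadv-lens-5).
-/

set_option autoImplicit false
set_option linter.dupNamespace false

namespace Summit.QuantumAdvantage.QuantumAdvantage.Theorems.PartyDial

open Finset
open Summit.QuantumAdvantage.AdviceFreeQNC0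

/-! ### §6b  Pair-separated strategies of the route's game (free zone + two segments, any positions) -/

section PairSep

variable {n : ℕ}

/-- a strategy is PAIR-SEPARATED with segments `≥ m₀`: some FREE zone `B` and a 2-colouring `sg` of the
other (active) coordinates into two segments of `≥ m₀` such that every cut reads, outside `B`, only its
own segment `pty g` and does NOT SPLIT the other segment (all of it before the cut, or all after).  No
line-order condition: cuts of either party may sit anywhere. -/
def IsPairLocal (m₀ : ℕ) (y : Fin (n + 1) → (Fin n → Bool) → Bool) : Prop :=
  ∃ (B : Finset (Fin n)) (sg : Fin n → ℕ) (pty : Fin (n + 1) → ℕ),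
    (∀ i, i ∉ B → sg i < 2) ∧ (∀ g, pty g < 2) ∧
    (∀ (i i' : Fin n) (g : Fin (n + 1)), i ∉ B → i' ∉ B → sg i ≠ pty g → sg i' = sg i →
      (i.val < g.val ↔ i'.val < g.val)) ∧
    (∀ (g : Fin (n + 1)) (u v : Fin n → Bool), (∀ i, i ∈ B ∨ sg i = pty g → u i = v i) → y g u = y g v) ∧
    (∀ j < 2, m₀ ≤ (univ.filter fun i : Fin n => i ∉ B ∧ sg i = j).card)

/-- 2-separated (line order) ⟹ pair-separated. -/
theorem isPairLocal_of_isSepLocal {m₀ : ℕ} {y : Fin (n + 1) → (Fin n → Bool) → Bool}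
    (hy : IsSepLocal 2 m₀ y) : IsPairLocal m₀ y := by
  obtain ⟨B, sg, pty, h1, h2, h3, h4, h5, h6⟩ := hy
  refine ⟨B, sg, pty, h1, h2, fun i i' g hi hi' hne heq => ?_, h5, h6⟩
  rcases lt_or_gt_of_ne hne with hlt | hgt
  · have a1 := h3 i g hi hlt
    have a2 := h3 i' g hi' (heq ▸ hlt)
    exact ⟨fun _ => a2, fun _ => a1⟩
  · have a1 := h4 i g hi hgt
    have a2 := h4 i' g hi' (heq ▸ hgt)
    constructor <;> intro h <;> omega

/-- pair-separation is monotone in the segment threshold. -/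
theorem IsPairLocal.mono {m₀ m₁ : ℕ} {y : Fin (n + 1) → (Fin n → Bool) → Bool} (hy : IsPairLocal m₀ y)
    (h : m₁ ≤ m₀) : IsPairLocal m₁ y := by
  obtain ⟨B, sg, pty, h1, h2, h3, h5, h6⟩ := hy
  exact ⟨B, sg, pty, h1, h2, h3, h5, fun j hj => h.trans (h6 j hj)⟩

/-- **The pair fibre law**: on each fibre of the free zone, a pair-separated strategy is a pair game of
§6 on the active coordinates (positions `posA`, shifted charges), so `pair_law_core` bounds it. -/
theorem pair_fibre_law {B : Finset (Fin n)} {m₀ : ℕ} (hm₀ : 1 ≤ m₀)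
    (c : ℕ) (y : Fin (n + 1) → (Fin n → Bool) → Bool) {sg : Fin n → ℕ} {pty : Fin (n + 1) → ℕ}
    (hsg : ∀ i, i ∉ B → sg i < 2) (hpty : ∀ g, pty g < 2)
    (hns : ∀ (i i' : Fin n) (g : Fin (n + 1)), i ∉ B → i' ∉ B → sg i ≠ pty g → sg i' = sg i →
      (i.val < g.val ↔ i'.val < g.val))
    (hloc : ∀ (g : Fin (n + 1)) (u v : Fin n → Bool), (∀ i, i ∈ B ∨ sg i = pty g → u i = v i) → y g u = y g v)
    (hsize : ∀ j < 2, m₀ ≤ (univ.filter fun i : Fin n => i ∉ B ∧ sg i = j).card) (t : Fin n → Bool) :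
    ((univ.filter fun a : Fin (Bᶜ.card) → Bool => ringWinU c y (glue B a t) = true).card : ℝ) ≤
      (1 - gam m₀ ^ 2) * (2 : ℝ) ^ (Bᶜ.card) := by
  have h := pair_law_core (bl := fun i' => sg (emb B i')) (fun g : Fin (n + 1) => posA B g.val) (pty := pty)
    (fun g : Fin (n + 1) => c + g.val + ((univ.filter fun i : Fin n => i ∈ B ∧ t i = true).card +
      (univ.filter fun i : Fin n => i ∈ B ∧ (i.val < g.val ∧ t i = true)).card))
    (fun g a' => y g (glue B a' t))
    (fun i' => hsg _ (emb_not_mem B i')) hpty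
    (fun i₁ i₂ g h h' => by
      rw [← emb_lt_iff, ← emb_lt_iff]
      exact hns _ _ g (emb_not_mem B _) (emb_not_mem B _) h h')
    (fun g a a' haa => hloc g _ _ fun i hi => by
      by_cases hB : i ∈ B
      · rw [glue_mem B a t hB, glue_mem B a' t hB]
      · have hs : sg i = pty g := hi.resolve_left hB
        have e1 := glue_emb B a t (idxA B i hB)
        have e2 := glue_emb B a' t (idxA B i hB)
        rw [emb_idxA] at e1 e2
        rw [e1, e2]
        exact haa _ (show sg (emb B (idxA B i hB)) = pty g by rw [emb_idxA]; exact hs))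
    hm₀ (fun j hj => by rw [← card_active B (fun i => sg i = j)]; exact hsize j hj)
  simp only [← ringWinU_glue] at h
  exact h

/-- **THE PAIR LAW** (`8/9`): a pair-separated strategy with segments `≥ m₀ ≥ 1` wins the route's game on
at most `(1 − γ(m₀)²)·2ⁿ` inputs — every `n`, every charge, no degree hypothesis, cuts anywhere. -/
theorem pair_law {m₀ : ℕ} (hm₀ : 1 ≤ m₀) (c : ℕ) (y : Fin (n + 1) → (Fin n → Bool) → Bool)
    (hy : IsPairLocal m₀ y) :
    ((univ.filter fun u : Fin n → Bool => ringWinU c y u = true).card : ℝ) ≤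
      (1 - gam m₀ ^ 2) * (2 : ℝ) ^ n := by
  obtain ⟨B, sg, pty, hsg, hpty, hns, hloc, hsize⟩ := hy
  exact law_of_fibres (B := B) _ c y fun t => pair_fibre_law hm₀ c y hsg hpty hns hloc hsize t

/-! ### §6c  FAN-IN: every strategy of fan-in `ℓ` with `8(ℓ+1)² ≤ n` is pair-separated -/

/-- cut `g`'s output depends on at most `ℓ` input bits (some read-set of size `≤ ℓ` determines it). -/
def FanIn (ℓ : ℕ) (y : Fin (n + 1) → (Fin n → Bool) → Bool) : Prop :=
  ∀ g, ∃ R : Finset (Fin n), R.card ≤ ℓ ∧ ∀ u v : Fin n → Bool, (∀ i ∈ R, u i = v i) → y g u = y g v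

end PairSep

section FanInSel

variable {n : ℕ}

/-- **Fan-in selection**: if every cut reads at most `ℓ` bits and `8(ℓ+1)² ≤ n`, two disjoint adjacent
pairs of coordinates `{2a, 2a+1}`, `{2b, 2b+1}` exist such that no cut reads both pairs, the cut `2b+1`
(the only position splitting the second pair) does not read the first and vice versa — a pair-separation
with segments `2` (everything else free).  Counting: `≤ (n+1)ℓ² + nℓ + n/2 < (n/2)²` bad pairs. -/
theorem isPairLocal_of_fanIn {ℓ : ℕ} {y : Fin (n + 1) → (Fin n → Bool) → Bool} (hy : FanIn ℓ y)
    (hn : 8 * (ℓ + 1) ^ 2 ≤ n) : IsPairLocal 2 y := by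
  classical
  choose R hRc hRl using hy
  set M := n / 2 with hM
  -- the pairs touched by each cut
  set A : Fin (n + 1) → Finset ℕ := fun g => (R g).image fun i : Fin n => i.val / 2 with hA
  have hAc : ∀ g, (A g).card ≤ ℓ := fun g => card_image_le.trans (hRc g)
  set A' : ℕ → Finset ℕ := fun m => if h : m < n + 1 then A ⟨m, h⟩ else ∅ with hA'
  have hA'g : ∀ g : Fin (n + 1), A' g.val = A g := fun g => by simp only [hA', dif_pos g.isLt]
  have hA'c : ∀ m, (A' m).card ≤ ℓ := fun m => by
    simp only [hA']
    split_ifs with h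
    · exact hAc _
    · simp
  -- the bad pairs
  set bad1 : Finset (ℕ × ℕ) := univ.biUnion fun g : Fin (n + 1) => A g ×ˢ A g with hbad1
  set bad2 : Finset (ℕ × ℕ) := (range M).biUnion fun b => A' (2 * b + 1) ×ˢ {b} with hbad2
  set bad3 : Finset (ℕ × ℕ) := (range M).biUnion fun a => {a} ×ˢ A' (2 * a + 1) with hbad3
  set diag : Finset (ℕ × ℕ) := (range M).image fun a => (a, a) with hdiag
  set bad := bad1 ∪ bad2 ∪ bad3 ∪ diag with hbad
  have hc1 : bad1.card ≤ (n + 1) * (ℓ * ℓ) := by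
    have h := card_biUnion_le_card_mul (univ : Finset (Fin (n + 1))) (fun g => A g ×ˢ A g) (ℓ * ℓ)
      (fun g _ => by rw [card_product]; exact Nat.mul_le_mul (hAc g) (hAc g))
    rwa [card_univ, Fintype.card_fin] at h
  have hc2 : bad2.card ≤ M * ℓ := by
    have h := card_biUnion_le_card_mul (range M) (fun b => A' (2 * b + 1) ×ˢ ({b} : Finset ℕ)) ℓ
      (fun b _ => by rw [card_product, card_singleton, mul_one]; exact hA'c _)
    rwa [card_range] at h
  have hc3 : bad3.card ≤ M * ℓ := by
    have h := card_biUnion_le_card_mul (range M) (fun a => ({a} : Finset ℕ) ×ˢ A' (2 * a + 1)) ℓ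
      (fun a _ => by rw [card_product, card_singleton, one_mul]; exact hA'c _)
    rwa [card_range] at h
  have hc4 : diag.card ≤ M := card_image_le.trans (card_range M).le
  have hcb : bad.card ≤ (n + 1) * (ℓ * ℓ) + M * ℓ + M * ℓ + M :=
    (card_union_le _ _).trans (add_le_add ((card_union_le _ _).trans (add_le_add
      ((card_union_le _ _).trans (add_le_add hc1 hc2)) hc3)) hc4)
  have hM4 : 4 * (ℓ + 1) ^ 2 ≤ M := by omega
  have hM1 : 1 ≤ M := le_trans (Nat.one_le_pow _ _ (by omega)) (le_trans (Nat.le_mul_of_pos_left _ (by norm_num)) hM4)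
  have hn2 : n + 1 ≤ 2 * M + 2 := by omega
  have hlt : bad.card < ((range M) ×ˢ (range M)).card := by
    rw [card_product, card_range]
    have e1 : M * (4 * (ℓ + 1) ^ 2) ≤ M * M := Nat.mul_le_mul_left M hM4
    have e2 : ℓ * ℓ ≤ M * (ℓ * ℓ) := Nat.le_mul_of_pos_left _ hM1
    have e3 : (n + 1) * (ℓ * ℓ) ≤ (2 * M + 2) * (ℓ * ℓ) := Nat.mul_le_mul_right _ hn2
    nlinarith [hcb, e1, e2, e3, hM1]
  obtain ⟨⟨a, b⟩, hq, hqb⟩ := exists_mem_notMem_of_card_lt_card hlt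
  simp only [mem_product, mem_range] at hq
  obtain ⟨ha, hb⟩ := hq
  have hnot1 : ∀ g, ¬ (a ∈ A g ∧ b ∈ A g) := fun g h =>
    hqb (by
      simp only [hbad, mem_union, hbad1, mem_biUnion, mem_univ, true_and, mem_product]
      exact Or.inl (Or.inl (Or.inl ⟨g, h⟩)))
  have hnot2 : a ∉ A' (2 * b + 1) := fun h =>
    hqb (by
      simp only [hbad, mem_union, hbad2, mem_biUnion, mem_range, mem_product, mem_singleton]
      exact Or.inl (Or.inl (Or.inr ⟨b, hb, h, rfl⟩)))
  have hnot3 : b ∉ A' (2 * a + 1) := fun h =>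
    hqb (by
      simp only [hbad, mem_union, hbad3, mem_biUnion, mem_range, mem_product, mem_singleton]
      exact Or.inl (Or.inr ⟨a, ha, rfl, h⟩))
  have hab : a ≠ b := fun h =>
    hqb (by
      simp only [hbad, mem_union, hdiag, mem_image, mem_range]
      exact Or.inr ⟨a, ha, by rw [h]⟩)
  have han : 2 * a + 1 < n := by omega
  have hbn : 2 * b + 1 < n := by omega
  -- reads land in pairs touched
  have hRA : ∀ g, ∀ i ∈ R g, i.val / 2 ∈ A g := fun g i hi => mem_image_of_mem _ hi
  -- the separation
  refine ⟨univ.filter fun i : Fin n => i.val / 2 ≠ a ∧ i.val / 2 ≠ b,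
    fun i => if i.val / 2 = a then 0 else 1,
    fun g => if a ∈ A g then 0 else if b ∈ A g then 1 else if g.val = 2 * b + 1 then 1 else 0,
    fun i _ => by dsimp only; split_ifs <;> omega, fun g => by dsimp only; split_ifs <;> omega,
    fun i i' g hi hi' hne heq => ?_, fun g u v huv => ?_, fun j hj => ?_⟩
  · -- non-splitting
    simp only [mem_filter, mem_univ, true_and, not_and, not_not] at hi hi'
    dsimp only at hne heq ⊢
    by_cases hia : i.val / 2 = a
    · -- both in the first pair; the cut is party 1, so it is not the cut `2a+1`
      rw [if_pos hia] at heq hne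
      have hi'a : i'.val / 2 = a := by
        by_contra h; rw [if_neg h] at heq; exact absurd heq (by norm_num)
      have hg : g.val ≠ 2 * a + 1 := by
        intro hg
        split_ifs at hne with h1 h2 h3
        · exact hne rfl
        · apply hnot3; rw [← hg, hA'g]; exact h2
        · omega
        · exact hne rfl
      constructor <;> intro h <;> omega
    · have hib : i.val / 2 = b := hi hia
      rw [if_neg hia] at heq hne
      have hi'a : i'.val / 2 ≠ a := by
        intro h; rw [if_pos h] at heq; exact absurd heq (by norm_num)
      have hi'b : i'.val / 2 = b := hi' hi'a
      have hg : g.val ≠ 2 * b + 1 := by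
        intro hg
        split_ifs at hne with h1 h2
        · apply hnot2; rw [← hg, hA'g]; exact h1
        · exact hne rfl
        · exact hne rfl
      constructor <;> intro h <;> omega
  · -- locality
    refine hRl g u v fun i hi => huv i ?_
    have hiA := hRA g i hi
    by_cases hia : i.val / 2 = a
    · right
      dsimp only
      rw [if_pos hia, if_pos (hia ▸ hiA)]
    · by_cases hib : i.val / 2 = b
      · right
        dsimp only
        have hbA : b ∈ A g := hib ▸ hiA
        have haA : a ∉ A g := fun h => hnot1 g ⟨h, hbA⟩
        rw [if_neg hia, if_neg haA, if_pos hbA]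
      · left
        simp only [mem_filter, mem_univ, true_and]
        exact ⟨hia, hib⟩
  · -- sizes: each pair has two elements
    interval_cases j
    · have hsub : ({⟨2 * a, by omega⟩, ⟨2 * a + 1, han⟩} : Finset (Fin n)) ⊆
          univ.filter fun i : Fin n => i ∉ (univ.filter fun i : Fin n => i.val / 2 ≠ a ∧ i.val / 2 ≠ b) ∧
            (if i.val / 2 = a then 0 else 1) = 0 := by
        intro x hx
        simp only [mem_insert, mem_singleton] at hx
        simp only [mem_filter, mem_univ, true_and, not_and, not_not]
        have hxa : x.val / 2 = a := by
          rcases hx with rfl | rfl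
          all_goals simp
          all_goals omega
        exact ⟨fun h => absurd hxa h, by rw [if_pos hxa]⟩
      refine le_trans ?_ (card_le_card hsub)
      rw [card_pair (fun h => by have := congrArg Fin.val h; simp at this)]
    · have hsub : ({⟨2 * b, by omega⟩, ⟨2 * b + 1, hbn⟩} : Finset (Fin n)) ⊆
          univ.filter fun i : Fin n => i ∉ (univ.filter fun i : Fin n => i.val / 2 ≠ a ∧ i.val / 2 ≠ b) ∧
            (if i.val / 2 = a then 0 else 1) = 1 := by
        intro x hx
        simp only [mem_insert, mem_singleton] at hx
        simp only [mem_filter, mem_univ, true_and, not_and, not_not]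
        have hxb : x.val / 2 = b := by
          rcases hx with rfl | rfl
          all_goals simp
          all_goals omega
        have hxa : x.val / 2 ≠ a := fun h => hab (h.symm.trans hxb)
        exact ⟨fun _ => hxb, by rw [if_neg hxa]⟩
      refine le_trans ?_ (card_le_card hsub)
      rw [card_pair (fun h => by have := congrArg Fin.val h; simp at this)]

/-- **FAN-IN LAW** (`35/36`): every strategy whose cuts read at most `ℓ` bits each, `8(ℓ+1)² ≤ n`, wins
the route's game on at most `(1 − γ(2)²)·2ⁿ = (35/36)·2ⁿ` inputs — any positions, any wiring, every
charge, no degree hypothesis. -/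
theorem fanInLaw {ℓ : ℕ} (hn : 8 * (ℓ + 1) ^ 2 ≤ n) (c : ℕ) (y : Fin (n + 1) → (Fin n → Bool) → Bool)
    (hy : FanIn ℓ y) :
    ((univ.filter fun u : Fin n → Bool => ringWinU c y u = true).card : ℝ) ≤
      (1 - gam 2 ^ 2) * (2 : ℝ) ^ n :=
  pair_law (by norm_num) c y (isPairLocal_of_fanIn hy hn)

end FanInSel

/-! ### §6d  The pieces of `CharDial.FrobHardOdd` after §6: the fan-in-`√(n/8)` sector is decided -/

section PairPieces

variable {n : ℕ}

/-- a strategy outside the pair-separated sector has a WIDE cut: fan-in `> ℓ` whenever `8(ℓ+1)² ≤ n`. -/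
theorem not_fanIn_of_not_pairLocal {ℓ : ℕ} {y : Fin (n + 1) → (Fin n → Bool) → Bool}
    (hy : ¬ IsPairLocal 2 y) (hn : 8 * (ℓ + 1) ^ 2 ≤ n) : ¬ FanIn ℓ y :=
  fun h => hy (isPairLocal_of_fanIn h hn)

/-- piece (A″), the PAIR sector: `FrobHardOdd` restricted to degree-`(p−1)` strategies that are
pair-separated with segments `≥ 2` (free zone + two pairs, cuts anywhere, no splitting).  [PROVED for every
`n` with `θ = 35/36`, degree hypothesis unused: `pairFrobOdd_holds`; WEAKER than T; contains the separated
sector (A′) (`isPairLocal_of_isSepLocal`) and every strategy of fan-in `ℓ` with `8(ℓ+1)² ≤ n`] -/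
def PairFrobOdd : Prop :=
  ∀ (p : ℕ) [Fact p.Prime], 5 ≤ p → ∃ θ : ℝ, θ < 1 ∧ ∃ n₀ : ℕ, ∀ n ≥ n₀, ∀ c : ℕ,
    ∀ y : Fin (n + 1) → (Fin n → Bool) → Bool, (∀ g, HasDegF p (y g) (p - 1)) → IsPairLocal 2 y →
      ((univ.filter fun u : Fin n → Bool => ringWinU c y u = true).card : ℝ) ≤ θ * (2 : ℝ) ^ n

/-- piece (L), the BOUNDED FAN-IN sector (uniform form): `FrobHardOdd` restricted to strategies whose every
cut reads at most `ℓ` bits, for every `ℓ` with `8(ℓ+1)² ≤ n` — any wiring, any positions.  [PROVED for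
every `n` with `θ = 35/36`, degree hypothesis unused: `fanInFrobOdd_holds`; WEAKER than T] -/
def FanInFrobOdd : Prop :=
  ∀ (p : ℕ) [Fact p.Prime], 5 ≤ p → ∃ θ : ℝ, θ < 1 ∧ ∃ n₀ : ℕ, ∀ n ≥ n₀, ∀ c ℓ : ℕ, 8 * (ℓ + 1) ^ 2 ≤ n →
    ∀ y : Fin (n + 1) → (Fin n → Bool) → Bool, (∀ g, HasDegF p (y g) (p - 1)) → FanIn ℓ y →
      ((univ.filter fun u : Fin n → Bool => ringWinU c y u = true).card : ℝ) ≤ θ * (2 : ℝ) ^ n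

/-- piece (L_ℓ), bounded fan-in `ℓ` FIXED (the `NC⁰`-reading form of T: constant fan-in, `n → ∞`).
[PROVED with `θ = 35/36`, `n₀ = 8(ℓ+1)²`: `localFrobOdd_holds`; WEAKER than T] -/
def LocalFrobOdd (ℓ : ℕ) : Prop :=
  ∀ (p : ℕ) [Fact p.Prime], 5 ≤ p → ∃ θ : ℝ, θ < 1 ∧ ∃ n₀ : ℕ, ∀ n ≥ n₀, ∀ c : ℕ,
    ∀ y : Fin (n + 1) → (Fin n → Bool) → Bool, (∀ g, HasDegF p (y g) (p - 1)) → FanIn ℓ y →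
      ((univ.filter fun u : Fin n → Bool => ringWinU c y u = true).card : ℝ) ≤ θ * (2 : ℝ) ^ n

/-- piece (B″), the KNOTTED residual: `FrobHardOdd` restricted to degree-`(p−1)` strategies that are NOT
pair-separated — for every free zone and every two disjoint pairs of active coordinates, some cut reads
both pairs or the splitting cut of one pair reads the other; in particular (`not_fanIn_of_not_pairLocal`)
some cut has fan-in `> √(n/8) − 1`.  [T-implied: `knottedFrobOdd_of_frobHardOdd`; UNDECIDED — the first
residual of this chain on which the DEGREE hypothesis must bite (all decided sectors are degree-free);
`⟺ FrobHardOdd`: `frobHardOdd_iff_knotted`; implied by the §5 residual: `knottedFrobOdd_of_entangled`] -/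
def KnottedFrobOdd : Prop :=
  ∀ (p : ℕ) [Fact p.Prime], 5 ≤ p → ∃ θ : ℝ, θ < 1 ∧ ∃ n₀ : ℕ, ∀ n ≥ n₀, ∀ c : ℕ,
    ∀ y : Fin (n + 1) → (Fin n → Bool) → Bool, (∀ g, HasDegF p (y g) (p - 1)) → ¬ IsPairLocal 2 y →
      ((univ.filter fun u : Fin n → Bool => ringWinU c y u = true).card : ℝ) ≤ θ * (2 : ℝ) ^ n

/-- piece (A″) holds outright. -/
theorem pairFrobOdd_holds : PairFrobOdd := by
  intro p _ _
  refine ⟨1 - gam 2 ^ 2, by linarith [gam_two_sq_pos], 0, fun n _ c y _ hy => ?_⟩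
  exact pair_law (by norm_num) c y hy

/-- piece (L) holds outright. -/
theorem fanInFrobOdd_holds : FanInFrobOdd := by
  intro p _ _
  refine ⟨1 - gam 2 ^ 2, by linarith [gam_two_sq_pos], 0, fun n _ c ℓ hℓ y _ hy => ?_⟩
  exact fanInLaw hℓ c y hy

/-- piece (L_ℓ) holds outright, every `ℓ`. -/
theorem localFrobOdd_holds (ℓ : ℕ) : LocalFrobOdd ℓ := by
  intro p _ _
  refine ⟨1 - gam 2 ^ 2, by linarith [gam_two_sq_pos], 8 * (ℓ + 1) ^ 2, fun n hn c y _ hy => ?_⟩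
  exact fanInLaw hn c y hy

/-- T ⟹ (B″) (projection). -/
theorem knottedFrobOdd_of_frobHardOdd
    (hT : Summit.QuantumAdvantage.QuantumAdvantage.Theses.CharDial.FrobHardOdd) : KnottedFrobOdd := by
  intro p _ hp
  obtain ⟨θ, hθ, n₀, h⟩ := hT p hp
  exact ⟨θ, hθ, n₀, fun n hn c y hy _ => h n hn c y hy⟩

/-- ★★★ item 32598 from its KNOTTED residual alone. -/
theorem frobHardOdd_of_knotted (hB : KnottedFrobOdd) :
    Summit.QuantumAdvantage.QuantumAdvantage.Theses.CharDial.FrobHardOdd := by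
  intro p _ hp
  obtain ⟨θ₂, hθ₂, n₂, h₂⟩ := hB p hp
  refine ⟨max (1 - gam 2 ^ 2) θ₂, max_lt (by linarith [gam_two_sq_pos]) hθ₂, n₂, fun n hn c y hy => ?_⟩
  have h2 : (0 : ℝ) ≤ (2 : ℝ) ^ n := by positivity
  by_cases hS : IsPairLocal 2 y
  · exact (pair_law (by norm_num) c y hS).trans (mul_le_mul_of_nonneg_right (le_max_left _ _) h2)
  · exact (h₂ n hn c y hy hS).trans (mul_le_mul_of_nonneg_right (le_max_right _ _) h2)

/-- **The dial on T after §6**: `FrobHardOdd ⟺ KnottedFrobOdd` (the pair / fan-in sector is decided). -/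
theorem frobHardOdd_iff_knotted :
    Summit.QuantumAdvantage.QuantumAdvantage.Theses.CharDial.FrobHardOdd ↔ KnottedFrobOdd :=
  ⟨knottedFrobOdd_of_frobHardOdd, frobHardOdd_of_knotted⟩

/-- (B′) ⟹ (B″): the §5 residual implies the §6 residual (its class is smaller: `¬pair ⊆ ¬separated`). -/
theorem knottedFrobOdd_of_entangled (hB : EntangledFrobOdd) : KnottedFrobOdd := by
  intro p _ hp
  obtain ⟨θ, hθ, n₀, h⟩ := hB p hp
  exact ⟨θ, hθ, n₀, fun n hn c y hy hS => h n hn c y hy fun hS' => hS (isPairLocal_of_isSepLocal hS')⟩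

/-- (B″) ⟹ (B′) (through T). -/
theorem entangledFrobOdd_of_knotted (hB : KnottedFrobOdd) : EntangledFrobOdd :=
  entangledFrobOdd_of_frobHardOdd (frobHardOdd_of_knotted hB)

end PairPieces

end Summit.QuantumAdvantage.QuantumAdvantage.Theorems.PartyDial
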